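import Summits.BirchSwinnertonDyer.BirchSwinnertonDyer.Theorems.InertBadSignedBranchesInertBadAtThreeOfV4Rr
import HarnessLib

/-!
# PROPOSAL (width seat bsd-wall-cm-bed-w1 g21) — skeleton v10 of line `rubin_e1_inert_three` for crux `InertBadAtThree`
# (stmt-BirchSwinnertonDyer-19225): the ITEMISED held print (eighteen named facts, v9's set) and the research stub in RANGE FORM WITH A
# NON-TORSION RANGE POINT IN HAND (V4Rr@3) — the `p = 3` twin of 21341's v8.2 reshape — for the line's lead / the BED pen to adopt.

NOT the skeleton of record (that is `Lines/rubin_e1_inert_three.lean` v8, lead ibd-p1 g9; v9 = w1 g20's proposal, evidence #59). This file shows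
that the composition closes BY NAME from the two proposed stubs through this seat's landed `…InertBadAtThreeOfV4Rr.inertBadAtThree_of_V4Rr`
(= w1 g20's `…OfV4R.inertBadAtThree_of_V4R` — glue `…BedGlueMin` + BV mean door + R₃ with the quartic cell PROVED + heart from V4R@3 — fed by
`v4RThree_of_v4RrThree`, whose extra hypothesis is the THEOREM `…RangeWitness.exists_rangeWitness_of_eq_three` = R3 ∘ R2 ∘ R1, p719685/p719120/p719262).
Stubs (2 sorries): `stub_printedInputsAtThreeMinV10` (HELD print, the eighteen named facts of v9: (A) 8 + (B) 3 + (C) 4 + (D) 3) and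
`stub_V4RrThree` (RESEARCH: 21341's registered `stub_V4Rr` with `5 ≤ p` ↦ `p = 3`; = v9's V4R@3 + the non-torsion range-point hypothesis; implies
the v8 stub V4K@3 outright, `…OfV4RrBed.katzLineDivisibilityAtThree_of_V4Rr`; NOT in print; rider R1 at `p = 3`). Its prover HOLDS an infinite
range (first tool: `…RangeRigidity.eq_of_hasValueAt_range`, p720278 — `G` is unique for its frame). ONE odd-prime statement `V4Rr_odd` specialises
to this stub and to 21341's (`…HeartOfV4RrOddSpecialises`). Nothing here proves BSD, the crux, or V4Rr@3.
-/

set_option linter.dupNamespace false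
set_option autoImplicit false

noncomputable section

open scoped Classical NumberField
open NumberField IsDedekindDomain Field PowerSeries
open WeierstrassCurve
open Literature.NumberTheory.EllipticCurves Literature.NumberTheory.GaloisRepresentations
open Literature.NumberTheory.EllipticCurves.ModularForms Literature.NumberTheory.EllipticCurves.Rank1Residual
  Literature.NumberTheory.EllipticCurves.Hsieh2014 Literature.NumberTheory.EllipticCurves.GreenbergSelmer
  Literature.NumberTheory.EllipticCurves.Module Literature.NumberTheory.EllipticCurves.IwasawaDual
  Summit.BirchSwinnertonDyer.Rank1Residual Summit.BirchSwinnertonDyer.Rank1Residual.X11b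
  Summit.BirchSwinnertonDyer.Rank1Residual.X11b.AcSelmer
  Summit.BirchSwinnertonDyer.BirchSwinnertonDyer.Theorems.BiquadraticEisensteinDescentDefs
  Summit.BirchSwinnertonDyer.BirchSwinnertonDyer.Theorems.BiquadraticEisensteinDescentEisensteinHeartFlatCMInertBadKPrimeSelmerTower
  Summit.BirchSwinnertonDyer.BirchSwinnertonDyer.Theorems.BiquadraticEisensteinDescentEisensteinHeartFlatCMInertBadKPrimeShapiroDatum
  Summit.BirchSwinnertonDyer.BirchSwinnertonDyer.Theorems.BiquadraticEisensteinDescentEisensteinHeartFlatCMInertBadKPrimeCMDatumAdapter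

namespace Summit.BirchSwinnertonDyer.BirchSwinnertonDyer.Cruxes.InertBadAtThree.RubinE1InertThreeV10Proposal

open Summit.BirchSwinnertonDyer.BirchSwinnertonDyer.Theses
open Summit.BirchSwinnertonDyer.BirchSwinnertonDyer.Theorems

/-- **The HELD print of v10, itemised** — v8's `PrintedInputsAtThreeMin` WITHOUT group (E): (A) Gross–Zagier, Kolyvagin, Matar–Nekovář
(families), GZK, modularity `exists_isNewformOf`, Friedberg–Hoffstein, Rubin's CM BSD triple, Cassels' isogeny invariance; (B) Hsieh Thm A /
Thm B (any level), Liu–Zhang–Zhang; (C) Burungale–Tian, Monsky, Smith (CM), the Bhargava–Varma mean; (D) the three printed Manin facts.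
Eighteen named facts, each consumed by `…InertBadAtThreeOfV4Rr.inertBadAtThree_of_V4Rr`. [cite: BreuilConradDiamondTaylor2001, Thm. A] -/
def PrintedInputsAtThreeMinV10 : Prop :=
  ((∀ (N : ℕ) [NeZero N] (W : WeierstrassCurve ℚ) (K : Type) [Field K] [NumberField K],
      Literature.NumberTheory.EllipticCurves.gross_zagier N W K) ∧
    (∀ (N : ℕ) [NeZero N] (W : WeierstrassCurve ℚ) (K : Type) [Field K] [NumberField K],
      Literature.NumberTheory.EllipticCurves.kolyvagin N W K) ∧
    (∀ (N : ℕ) [NeZero N] (W : WeierstrassCurve ℚ) (K : Type) [Field K] [NumberField K],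
      Literature.NumberTheory.EllipticCurves.MatarNekovar2019.thm03_padicValNat_card_sha_le_of_irreducible N W K) ∧
    Literature.NumberTheory.EllipticCurves.rank_eq_analyticRank_of_analyticRank_le_one ∧
    Literature.NumberTheory.EllipticCurves.ModularForms.exists_isNewformOf ∧
    Literature.NumberTheory.EllipticCurves.friedbergHoffstein_exists_heegnerField_split_twist_ne_zero ∧
    Literature.NumberTheory.EllipticCurves.bsdTriple_of_hasCM_of_L_one_ne_zero ∧
    WeierstrassCurve.bsdRHS_eq_of_isIsogenous) ∧
  (Literature.NumberTheory.EllipticCurves.Hsieh2014.thmA_exists_isHsiehLFunction_unrPeriod_anyLevel ∧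
    Literature.NumberTheory.EllipticCurves.Hsieh2014.thmB_exists_isHsiehLFunction_coeff_norm_eq_one_unrPeriod_anyLevel ∧
    Literature.NumberTheory.EllipticCurves.LiuZhangZhang2018.thm151_thm153_modularCurve_heegnerVector_additive) ∧
  (Literature.NumberTheory.EllipticCurves.burungaleTian_analyticRank_eq_zero_of_selmerCorank_eq_zero_of_hasCM ∧
    Literature.NumberTheory.EllipticCurves.monsky_selmerCorank_two_mod_two_eq ∧
    (∀ (W : WeierstrassCurve ℚ) [W.IsElliptic], W.HasCM → Literature.NumberTheory.EllipticCurves.smith_selmerCorank_density W) ∧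
    Literature.NumberTheory.QuadraticFields.bv_threeTorsion_mean_imaginary_heegnerOdd) ∧
  (Literature.NumberTheory.EllipticCurves.ModularForms.mazur_not_dvd_maninConstant_of_odd ∧
    Literature.NumberTheory.EllipticCurves.ModularForms.abbesUllmo_not_dvd_maninConstant_of_not_dvd_level ∧
    Literature.NumberTheory.EllipticCurves.ModularForms.cesnavicius_not_two_dvd_maninConstant_of_two_dvd_level)

/-- STUB (HELD, print only — never a worker target): the eighteen named facts. [cite: BreuilConradDiamondTaylor2001, Thm. A] -/
theorem stub_printedInputsAtThreeMinV10 : PrintedInputsAtThreeMinV10 := by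
  sorry

/-- STUB (RESEARCH, NOT IN PRINT): **V4Rr@3** — 21341's registered `stub_V4Rr` (skeleton v8.2) with `5 ≤ p` ↦ `p = 3`: v9's V4R@3 with ONE extra
hypothesis after the `ι′`-clause, a NON-TORSION point of Hsieh's range (a theorem: `…RangeWitness.exists_rangeWitness_of_eq_three`), so its prover
holds an infinite range. Content: the λ-part Eisenstein divisibility on the Katz `K′`-line of `(L = K′·K_CM, Σ induced from K′)` for `ψ_W∘N_{L/K_CM}` on
the niveau-2 tame branch at `p = 3`. Rider R1 (Hsieh JAMS L.7.15 / P.7.16 use `p > 3`). [cite: Hsieh2014JAMS, Thm. 8.14, L.7.15, P.7.16] -/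
theorem stub_V4RrThree :
    ∀ (W : WeierstrassCurve ℚ) [W.IsElliptic] [W.IsGloballyMinimal] (p : ℕ) [Fact p.Prime]
    [NeZero (W.conductorNorm ℤ)] (K : Type) [Field K] [NumberField K],
    W.HasCM → p = 3 → CMInert W p → ¬ Good W p →
    IsImaginaryQuadratic K → SatisfiesHeegnerHypothesis (W.conductorNorm ℤ) K →
    4 < (NumberField.discr K).natAbs → ¬ p ∣ NumberField.classNumber K →
    ∀ (κ : ZpExtension K p), κ.IsAnticyclotomic →
      ∀ (γ : Field.absoluteGaloisGroup K) [Fact (κ.IsTopGenerator γ)]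
        (𝔭 : HeightOneSpectrum (𝓞 K)), ((p : ℕ) : 𝓞 K) ∈ 𝔭.asIdeal →
        𝔭.asIdeal.ramificationIdx (𝓞 ℚ) = 1 → 𝔭.asIdeal.inertiaDeg (𝓞 ℚ) = 1 →
        ∀ (f : CuspForm (CongruenceSubgroup.Gamma0 (W.conductorNorm ℤ)) 2), IsNewformOf W f →
          ∀ (ι' : PadicAlgCl p ≃+* ℂ),
            (∀ (w : InfinitePlace K) (k : 𝓞 K), k ∈ 𝔭.asIdeal ↔ ‖ι'.symm (w.embedding (k : K))‖ < 1) →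
            (∃ (χ : HeckeCharacter K) (n : ℕ) (r : FramedGaloisRep K (PadicAlgCl p) 1), 0 < n ∧
                (∀ v : HeightOneSpectrum (𝓞 K), χ.IsUnramifiedAt v) ∧
                χ.HasInfinityType (fun _ ↦ (n : ℤ)) (fun _ ↦ -(n : ℤ)) ∧
                IsPAdicAvatarOf ι' χ r ∧ FactorsThroughZp κ r ∧ ∀ q : ℕ, 0 < q → avatarValueAt r γ ^ q ≠ 1) →
                ∀ (𝔭' : HeightOneSpectrum (𝓞 K)), ((p : ℕ) : 𝓞 K) ∈ 𝔭'.asIdeal → 𝔭' ≠ 𝔭 →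
                Module.IsTorsion (IwasawaAlgebra p) (XAc (W.baseChange K) p κ 𝔭' ∅ γ) →
                ∀ (L : Type) [Field L] [NumberField L] [Algebra K L] [IsGalois K L]
                  (Sp S T : Finset (HeightOneSpectrum (𝓞 L))) (lam : HeckeCharacter L) (ϑ : L) (CK : ℂ)
                  (Ω : InfinitePlace L → ℂ) (ΩpK : InfinitePlace L → ℂ_[p]) (G : PowerSeries 𝓞_ℂ_[p])
                  (w₁ w₂ : InfinitePlace L) (cL cL' : ℂ),
                  w₁ ≠ w₂ → (∀ w : InfinitePlace L, w = w₁ ∨ w = w₂) →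
                  (∀ (χ : HeckeCharacter K) (n : ℕ), 0 < n → (∀ v : HeightOneSpectrum (𝓞 K), χ.IsUnramifiedAt v) →
                    χ.HasInfinityType (fun _ ↦ (n : ℤ)) (fun _ ↦ -(n : ℤ)) →
                    KatzCM.HasKatzType ι' Sp (lam * χ.compRelNorm L) 1 (fun w ↦ if w = w₁ then n else n - 1)) →
                  (∀ (χ : HeckeCharacter K) (n : ℕ), 0 < n → (∀ v : HeightOneSpectrum (𝓞 K), χ.IsUnramifiedAt v) →
                    χ.HasInfinityType (fun _ ↦ (n : ℤ)) (fun _ ↦ -(n : ℤ)) →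
                    LFunction.HasEntireContinuation (heckeLFunction (lam * χ.compRelNorm L))) →
                  cL ≠ 0 → cL' ≠ 0 →
                  (∀ (χ : HeckeCharacter K) (n : ℕ), 0 < n → (∀ v : HeightOneSpectrum (𝓞 K), χ.IsUnramifiedAt v) →
                    χ.HasInfinityType (fun _ ↦ (n : ℤ)) (fun _ ↦ -(n : ℤ)) →
                    ∀ hL : LFunction.HasEntireContinuation (heckeLFunction (lam * χ.compRelNorm L)),
                      hL.continuation 0 = cL * cL' ^ n * rankinSelbergValueHecke f χ 1) →
                  (∀ w ∈ S ∪ KatzCM.primesOver L p, ¬ lam.IsUnramifiedAt w) →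
                  (∀ w ∈ Sp ∪ T, ¬ lam.IsUnramifiedAt w) →
                  CK ≠ 0 → (∀ w, Ω w ≠ 0) → (∀ w, (KatzCM.embeddingAt ι' Sp w ϑ).im ≠ 0) → (∀ w, ΩpK w ≠ 0) →
                  (∀ (χ : HeckeCharacter K) (n : ℕ), 0 < n → (∀ v : HeightOneSpectrum (𝓞 K), χ.IsUnramifiedAt v) →
                    χ.HasInfinityType (fun _ ↦ (n : ℤ)) (fun _ ↦ -(n : ℤ)) →
                    ∀ r : FramedGaloisRep K (PadicAlgCl p) 1, IsPAdicAvatarOf ι' χ r → FactorsThroughZp κ r →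
                    ∀ hL : LFunction.HasEntireContinuation (heckeLFunction (lam * χ.compRelNorm L)),
                      IntSeries.HasValueAt G (avatarValueAt r γ - 1)
                        ((((ι'.symm (KatzCM.interpolationValue ι' Sp S T lam (χ.compRelNorm L) 1
                            (fun w ↦ if w = w₁ then n else n - 1) ϑ CK Ω (hL.continuation 0))) : PadicAlgCl p) : ℂ_[p]) *
                          ∏ w, ΩpK w ^ (1 + 2 * (fun w ↦ if w = w₁ then n else n - 1) w))) →
                ∀ (d₀ : ℤ) (r : AlgebraicClosure K) (ψ : (W.baseChange K).geomPoints →+ (W.baseChange K).geomPoints),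
                  r * r = algebraMap K (AlgebraicClosure K) (d₀ : K) →
                  r ∉ Set.range (algebraMap K (AlgebraicClosure K)) →
                  (∀ y : ZMod p, y * y ≠ PadicInt.toZMod ((d₀ : ℤ) : ℤ_[p])) →
                  (∀ σ : absoluteGaloisGroup K, σ • r = r → ∀ P : (W.baseChange K).geomPoints, σ • ψ P = ψ (σ • P)) →
                  (∀ σ : absoluteGaloisGroup K, σ • r = -r → ∀ P : (W.baseChange K).geomPoints, σ • ψ P = -ψ (σ • P)) →
                  (∀ P, ψ (ψ P) = d₀ • P) →
                ∀ (U : Subgroup (absoluteGaloisGroup K)) [U.Normal], (∀ σ, σ ∈ U ↔ σ • r = r) →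
                ∀ (φ : (W.baseChange K).geomPrimaryTorsion p →+ (W.baseChange K).geomPrimaryTorsion p)
                  (_ : ∀ m, ((φ m : (W.baseChange K).geomPrimaryTorsion p) : (W.baseChange K).geomPoints) = ψ m)
                  (hφH' : ∀ (x : (κ.kerSubgroup ⊓ U : Subgroup (absoluteGaloisGroup K)))
                    (m : (W.baseChange K).geomPrimaryTorsion p), φ (x • m) = x • φ m)
                  (hφU : ∀ σ ∈ U, ∀ m : (W.baseChange K).geomPrimaryTorsion p, φ (σ • m) = σ • φ m)
                  (hφU' : ∀ σ, σ ∉ U → ∀ m : (W.baseChange K).geomPrimaryTorsion p, φ (σ • m) = -(σ • φ m))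
                  (hφ2 : ∀ m, φ (φ m) = d₀ • m)
                  (γ' : absoluteGaloisGroup K) (_ : κ.IsTopGenerator γ') (_ : γ' ∈ U)
                  (f₁ : AddMonoid.End (selmerOver (κ.kerSubgroup ⊓ U) ((W.baseChange K).geomPrimaryTorsion p) p 𝔭' ∅))
                  (_hf : ∀ s, ((f₁ s : selmerOver (κ.kerSubgroup ⊓ U) ((W.baseChange K).geomPrimaryTorsion p) p 𝔭' ∅) :
                    subgroupH1 (κ.kerSubgroup ⊓ U) ((W.baseChange K).geomPrimaryTorsion p)) =
                      conjH1 (κ.kerSubgroup ⊓ U) ((W.baseChange K).geomPrimaryTorsion p) γ' s)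
                  (h : IsLocNil p (f₁ - 1))
                  (δ : LocNilDual (selmerOver (κ.kerSubgroup ⊓ U) ((W.baseChange K).geomPrimaryTorsion p) p 𝔭' ∅) f₁ h
                    →ₗ[IwasawaAlgebra p]
                    LocNilDual (selmerOver (κ.kerSubgroup ⊓ U) ((W.baseChange K).geomPrimaryTorsion p) p 𝔭' ∅) f₁ h)
                  (hδ : ∀ (x : LocNilDual (selmerOver (κ.kerSubgroup ⊓ U) ((W.baseChange K).geomPrimaryTorsion p) p 𝔭' ∅) f₁ h)
                    (s t : selmerOver (κ.kerSubgroup ⊓ U) ((W.baseChange K).geomPrimaryTorsion p) p 𝔭' ∅),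
                    (t : subgroupH1 (κ.kerSubgroup ⊓ U) ((W.baseChange K).geomPrimaryTorsion p)) =
                      resH1Hom (ContinuousMonoidHom.id _) φ hφH'
                        (s : subgroupH1 (κ.kerSubgroup ⊓ U) ((W.baseChange K).geomPrimaryTorsion p)) → δ x s = x t)
                  (b : Module.Basis (Fin 2) ℤ_[p]
                    (AdjoinRoot (Polynomial.X ^ 2 - Polynomial.C ((d₀ : ℤ) : ℤ_[p]) : Polynomial ℤ_[p]))) (hb0 : b 0 = 1)
                  (hb1 : b 1 * b 1 = algebraMap ℤ_[p]
                    (AdjoinRoot (Polynomial.X ^ 2 - Polynomial.C ((d₀ : ℤ) : ℤ_[p]) : Polynomial ℤ_[p])) ((d₀ : ℤ) : ℤ_[p]))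
                  (ι : AdjoinRoot (Polynomial.X ^ 2 - Polynomial.C ((d₀ : ℤ) : ℤ_[p]) : Polynomial ℤ_[p]) →+* 𝓞_ℂ_[p])
                  (_ : ι.comp (algebraMap ℤ_[p] _) = R1.toCpInt p),
                  ∃ m : ℕ, ∀ x ∈ (charIdeal (PowerSeries
                      (AdjoinRoot (Polynomial.X ^ 2 - Polynomial.C ((d₀ : ℤ) : ℤ_[p]) : Polynomial ℤ_[p])))
                      (WithQuadratic (LocNilDual (selmerOver (κ.kerSubgroup ⊓ U) ((W.baseChange K).geomPrimaryTorsion p)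
                        p 𝔭' ∅) f₁ h) b hb0 hb1 δ
                        (delta_sq (W.baseChange K) κ 𝔭' ∅ U φ hφH' hφU hφU' d₀ hφ2 f₁ h δ hδ))).map (PowerSeries.map ι),
                    (PowerSeries.C ((p : ℕ) : 𝓞_ℂ_[p]) : PowerSeries 𝓞_ℂ_[p]) ^ m * x ∈ Ideal.span {G} := by
  sorry

/-- **The composition (v10): the crux BY NAME from the two stubs** — `…InertBadAtThreeOfV4Rr.inertBadAtThree_of_V4Rr` with the eighteen
projections of the held print and V4Rr@3. [cite: Hsieh2014, Thm. A and Thm. B p. 712 (Doc. Math. 19)] -/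
theorem InertBadAtThree_proof : InertBadSignedBranches.InertBadAtThree :=
  have hI := stub_printedInputsAtThreeMinV10
  InertBadSignedBranchesInertBadAtThreeOfV4Rr.inertBadAtThree_of_V4Rr
    hI.1.1 hI.1.2.1 hI.1.2.2.1 hI.1.2.2.2.1 hI.1.2.2.2.2.1 hI.1.2.2.2.2.2.1 hI.1.2.2.2.2.2.2.1 hI.1.2.2.2.2.2.2.2
    hI.2.1.1 hI.2.1.2.1 hI.2.1.2.2 hI.2.2.1.1 hI.2.2.1.2.1 hI.2.2.1.2.2.1 hI.2.2.1.2.2.2 hI.2.2.2.1 hI.2.2.2.2.1 hI.2.2.2.2.2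
    stub_V4RrThree

end Summit.BirchSwinnertonDyer.BirchSwinnertonDyer.Cruxes.InertBadAtThree.RubinE1InertThreeV10Proposal

end
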